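import Summits.QuantumFields.BalabanUV.T4Continuum.Support.SmoothRefineSlices
import Summits.QuantumFields.BalabanUV.T4Continuum.Support.SmoothRefineWhitney
import Summits.QuantumFields.BalabanUV.T4Continuum.Support.AbelianBlockAverage
import HarnessLib

/-!
# T⁴ programme, node NE3 — the kinematic refinement lemma, abelian line, file 7: THE BLOCK AVERAGE AND THE PLAQUETTES OF
# `slicePull U · exp c` IN A COMMUTATIVE COEFFICIENT ALGEBRA (`SmoothRefineAbelian`)

Cell `pub-balaban`, NE3 formalisation swarm (`t4/formal/NE3/LEAVES.md` row S4b, unit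
`b2b-balaban-t4-ne3-formalise-leaf-10`); sequel of `SmoothRefineSlices`, `SmoothRefineWhitney` and of row S4b-i's
`AbelianBlockAverage` (leaf-03: in a COMMUTATIVE complete normed `ℂ`-algebra, `hol (exp ∘ A) = exp (A(Γ))` and Bałaban's
average (42) of `exp ∘ A` is `exp (T_c(A))` EXACTLY, `T_c` = the tree's `B7Prop1Explicit.Tside`, [Balaban1985Averaging]
(47)–(48) p. 25).  Here the configuration is the product of the SLICE PULLBACK of a coarse configuration `U` and an
exponential fine configuration: `refineCfg L U c := slicePull L U · expUnit ∘ c`.  In a commutative algebra: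

§1 transporters of pointwise products are products of transporters (`hol_mul`, `Wcx_mul`);
§2 THE AVERAGE (42) OF `refineCfg L U c` IS `U · exp (T_c(c))` EXACTLY (inside the ball of the logarithm):
`bavg L (refineCfg L U c) (L • z) κ = U z κ * expUnit (Tside L c (L • z) κ)` — the loop variables of (42) do not see the
pullback (`SmoothRefineSlices.Wcx_slicePull`), the straight contour reads `U z κ` on it (`hol_slicePull_seg`); hence
`rescale L (bavg L (refineCfg L U c)) = U` AS SOON AS ALL CONTOUR AVERAGES OF `c` VANISH (`rescale_bavg_refineCfg`) — the
exactness mechanism of row S4b (no fixed point, no pre-compensation: the neutralised Whitney potential of file 5 has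
vanishing contour averages);
§3 the fine plaquettes: `hol (refineCfg L U c) y (plaqWord μ ν) = [corner ? U(∂P_{⌊y/L⌋}) : 1] * expUnit (dC c (y; μ, ν))`.

HONEST FRAMING: finite-`T⁴` kinematics of block averaging in the ABELIAN sanity case (rung (B)+1 — NOT infinite volume, NOT
a mass gap, NOT Clay); no estimate of the programme, nothing of NE3 claimed (NE3-(A) stays CONDITIONAL on
⟨(H1), (H3ˢᵘᵖ), (H0), SmoothRefine⟩ with the non-abelian kinematic lemma OPEN); no `BetaPertH`, no (B), no G-an2-4; no
printed sentence is a hypothesis.  PLACEMENT (human rule 2026-08-19): our work, under `Summits/QuantumFields/BalabanUV/`.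
-/

set_option autoImplicit false

open scoped BigOperators

namespace Summit.QuantumFields.BalabanUV.T4Continuum.SmoothRefineAbelian

open Literature.MathematicalPhysics.QuantumFieldTheory.Balaban1983to89
open B7Prop1Explicit B7Prop2Explicit SmoothRefineBlocks SmoothRefineSlices SmoothRefineWhitney AbelianBlockAverage
open NormedSpace

noncomputable section

variable {d : ℕ}


/-! ## §1 Transporters of pointwise products (commutative structure group) -/

section CommGroup

variable {G : Type*} [CommGroup G]

/-- One letter of a pointwise product. [folklore] -/
theorem stepHol_mul (V V' : Site d → Fin d → G) (x : Site d) (l : Letter d) :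
    stepHol (fun y μ => V y μ * V' y μ) x l = stepHol V x l * stepHol V' x l := by
  obtain ⟨μ, b⟩ := l
  cases b
  · simp only [stepHol, Bool.false_eq_true, ↓reduceIte, mul_inv]
  · simp [stepHol]

/-- **In a commutative structure group the transporter of a pointwise product is the product of the transporters.**
[folklore] -/
theorem hol_mul (V V' : Site d → Fin d → G) :
    ∀ (x : Site d) (w : List (Letter d)), hol (fun y μ => V y μ * V' y μ) x w = hol V x w * hol V' x w
  | x, [] => by simp
  | x, l :: w => by
    rw [hol_cons, hol_cons, hol_cons, stepHol_mul, hol_mul V V' (x + l.vec) w, mul_mul_mul_comm]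

end CommGroup

/-! ## §2 The block average of `slicePull U · exp c` -/

section Comm

variable {𝔸 : Type*} [NormedCommRing 𝔸] [NormedAlgebra ℂ 𝔸] [CompleteSpace 𝔸]

/-- THE REFINED CONFIGURATION of row S4b: the slice pullback of the coarse configuration times an exponential fine
configuration. [folklore] -/
def refineCfg (L : ℕ) (U : Site d → Fin d → 𝔸ˣ) (c : Site d → Fin d → 𝔸) : Site d → Fin d → 𝔸ˣ :=
  fun y μ => slicePull L U y μ * expUnit (c y μ)

omit [NormedAlgebra ℂ 𝔸] [CompleteSpace 𝔸] in
/-- The loop variables of (42) of a pointwise product. [folklore] -/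
theorem Wcx_mul (L : ℕ) (V V' : Site d → Fin d → 𝔸ˣ) (q : Site d) (κ : Fin d) (r : Site d) :
    Wcx L (fun y μ => V y μ * V' y μ) q κ r = Wcx L V q κ r * Wcx L V' q κ r := by
  simp only [Wcx, hol_mul, mul_inv, mul_mul_mul_comm]

/-- The transporters of the refined configuration factor. [folklore] -/
theorem hol_refineCfg (L : ℕ) (U : Site d → Fin d → 𝔸ˣ) (c : Site d → Fin d → 𝔸) (x : Site d) (w : List (Letter d)) :
    hol (refineCfg L U c) x w = hol (slicePull L U) x w * hol (fun y μ => expUnit (c y μ)) x w :=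
  hol_mul (slicePull L U) (fun y μ => expUnit (c y μ)) x w

/-- **The loop variables of the refined configuration do not see the pullback**:
`Wcx L (refineCfg L U c) (L • z) κ (boxVec r) = expUnit (c(Γ_{c,x} ∪ (−Γ_c)))`. [folklore] -/
theorem Wcx_refineCfg {L : ℕ} (hL : 1 ≤ L) (U : Site d → Fin d → 𝔸ˣ) (c : Site d → Fin d → 𝔸) (z : Site d)
    (κ : Fin d) (r : Fin d → Fin L) :
    Wcx L (refineCfg L U c) ((L : ℤ) • z) κ (boxVec L r) =
      expUnit (asum c ((L : ℤ) • z) (gammaWord L κ (boxVec L r) ++ seg κ (-(L : ℤ)))) := by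
  have h : Wcx L (refineCfg L U c) ((L : ℤ) • z) κ (boxVec L r)
      = Wcx L (slicePull L U) ((L : ℤ) • z) κ (boxVec L r) * Wcx L (fun y μ => expUnit (c y μ)) ((L : ℤ) • z) κ (boxVec L r) :=
    Wcx_mul L (slicePull L U) (fun y μ => expUnit (c y μ)) _ κ _
  rw [h, Wcx_slicePull hL, one_mul, Wcx_expUnit]

/-- The exponent of (42) of the refined configuration, inside the ball of the logarithm: `X_c = X̂_c(c)`. [folklore] -/
theorem Xavg_refineCfg {L : ℕ} (hL : 1 ≤ L) (U : Site d → Fin d → 𝔸ˣ) (c : Site d → Fin d → 𝔸) (z : Site d)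
    (κ : Fin d)
    (hsmall : ∀ r : Fin d → Fin L,
      ‖asum c ((L : ℤ) • z) (gammaWord L κ (boxVec L r) ++ seg κ (-(L : ℤ)))‖ < Real.log 2) :
    Xavg L (refineCfg L U c) ((L : ℤ) • z) κ = Xhat L c ((L : ℤ) • z) κ := by
  unfold Xavg Xhat
  refine Finset.sum_congr rfl fun r _ => ?_
  rw [Wcx_refineCfg hL, val_expUnit, B7BlockAvgLog.mlog_exp (hsmall r)]

/-- The straight contour of a coarse bond on the refined configuration: `U z κ * exp (c(Γ_c))`. [folklore] -/
theorem hol_refineCfg_seg {L : ℕ} (hL : 1 ≤ L) (U : Site d → Fin d → 𝔸ˣ) (c : Site d → Fin d → 𝔸) (z : Site d)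
    (κ : Fin d) :
    hol (refineCfg L U c) ((L : ℤ) • z) (seg κ L) = U z κ * expUnit (asum c ((L : ℤ) • z) (seg κ L)) := by
  rw [hol_refineCfg, hol_slicePull_seg hL, (blk_res_smul hL z).1, hol_expUnit]

/-- **THE BLOCK AVERAGE (42) OF THE REFINED CONFIGURATION, EXACTLY**: `bavg L (refineCfg L U c) (L • z) κ =
U z κ · exp (T_c(c))`, `T_c(c) = Tside L c (L • z) κ` the linear contour average of the fine cochain. [folklore] -/
theorem bavg_refineCfg {L : ℕ} (hL : 1 ≤ L) (U : Site d → Fin d → 𝔸ˣ) (c : Site d → Fin d → 𝔸) (z : Site d)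
    (κ : Fin d)
    (hsmall : ∀ r : Fin d → Fin L,
      ‖asum c ((L : ℤ) • z) (gammaWord L κ (boxVec L r) ++ seg κ (-(L : ℤ)))‖ < Real.log 2) :
    bavg L (refineCfg L U c) ((L : ℤ) • z) κ = U z κ * expUnit (Tside L c ((L : ℤ) • z) κ) := by
  rw [show bavg L (refineCfg L U c) ((L : ℤ) • z) κ
      = expUnit (Xavg L (refineCfg L U c) ((L : ℤ) • z) κ) * hol (refineCfg L U c) ((L : ℤ) • z) (seg κ L) from rfl,
    Xavg_refineCfg hL U c z κ hsmall, hol_refineCfg_seg hL, mul_left_comm]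
  congr 1
  apply Units.ext
  letI : NormedAlgebra ℚ 𝔸 := NormedAlgebra.restrictScalars ℚ ℂ 𝔸
  rw [Units.val_mul, val_expUnit, val_expUnit, val_expUnit, ← exp_add_of_commute (Commute.all _ _), Xhat_eq L hL,
    sub_add_cancel]

/-- **EXACTNESS**: if every contour average of the fine cochain vanishes (and the loop sums lie in the ball of the
logarithm), the rescaled block average of the refined configuration IS the coarse configuration:
`rescale L (bavg L (refineCfg L U c)) = U`. [folklore] -/
theorem rescale_bavg_refineCfg {L : ℕ} (hL : 1 ≤ L) (U : Site d → Fin d → 𝔸ˣ) (c : Site d → Fin d → 𝔸)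
    (hsmall : ∀ (z : Site d) (κ : Fin d) (r : Fin d → Fin L),
      ‖asum c ((L : ℤ) • z) (gammaWord L κ (boxVec L r) ++ seg κ (-(L : ℤ)))‖ < Real.log 2)
    (hT : ∀ (z : Site d) (κ : Fin d), Tside L c ((L : ℤ) • z) κ = 0) :
    rescale L (bavg L (refineCfg L U c)) = U := by
  funext z κ
  rw [rescale, bavg_refineCfg hL U c z κ (hsmall z κ), hT]
  rw [show expUnit (0 : 𝔸) = 1 from Units.ext (by simp), mul_one]

/-! ## §3 The fine plaquettes of the refined configuration -/

/-- **The fine plaquettes of `slicePull U · exp c`**: the corner pullback of the coarse plaquette times the exponential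
of the coboundary of `c`. [folklore] -/
theorem hol_refineCfg_plaqWord {L : ℕ} (hL : 1 ≤ L) (U : Site d → Fin d → 𝔸ˣ) (c : Site d → Fin d → 𝔸) (y : Site d)
    {μ ν : Fin d} (hμν : μ ≠ ν) :
    hol (refineCfg L U c) y (plaqWord μ ν) =
      (if res L y μ = (L : ℤ) - 1 ∧ res L y ν = (L : ℤ) - 1 then hol U (blk L y) (plaqWord μ ν) else 1) *
        expUnit (dC c y μ ν) := by
  rw [hol_refineCfg, hol_slicePull_plaqWord hL U y hμν, hol_expUnit, asum_plaqWord]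
  rfl

/-- Periodicity of the refined configuration. [folklore] -/
theorem refineCfg_add_period {L : ℕ} (hL : 1 ≤ L) (U : Site d → Fin d → 𝔸ˣ) (c : Site d → Fin d → 𝔸) {P : ℤ}
    (hU : ∀ (z : Site d) (κ μ : Fin d), U (z + P • e κ) μ = U z μ)
    (hc : ∀ (y : Site d) (κ μ : Fin d), c (y + ((L : ℤ) * P) • e κ) μ = c y μ) (y : Site d) (κ μ : Fin d) :
    refineCfg L U c (y + ((L : ℤ) * P) • e κ) μ = refineCfg L U c y μ := by
  simp only [refineCfg, slicePull_add_period hL U hU, hc]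

end Comm

end

end Summit.QuantumFields.BalabanUV.T4Continuum.SmoothRefineAbelian
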